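import Mathlib
import Summits.KontsevichZagierPeriods.KontsevichZagierPeriods.Theorems.SoloInformedShuffleLinExt
import HarnessLib
import HarnessLib.Audit

/-!
# SoloInformed — THEOREM XLII: the shuffle product of all multiple zeta classes in `𝒫`
# (PROGRAMME XLII, file 3)

Solo programme `solo-KontsevichZagierPeriods-informed`, session s47. In the formal period ring
`𝒫 = KZ.FormalPeriodRing` (generators `[D, f]`, relations = Kontsevich–Zagier's rules; NO identity
between real numbers is ever used) the product of two multiple zeta classes of admissible indices
`s, t` is the sum, over all interleavings `W` of their binary words, of the classes of the indices
read off `W`: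

  `mzvClass s * mzvClass t = ∑_{W ∈ bw(s) ш bw(t)} mzvClass (ofBinaryWord W)`

(`soloInformed_mzvClass_mul_eq_sum_shuffleWord`) — the SHUFFLE PRODUCT FORMULA of Kontsevich's
iterated integrals, in all depths and weights, as an identity between abstract periods. The moves:
Fubini (the product of `𝒫`: `[Δ_a, ω_s] · [Δ_b, ω_t] = [Δ_a × Δ_b, ω_s ⊗ ω_t]`), rule (1a) along the
order cells of the linear extensions `σ` of the two chains (engine THM XXXVIII,
`soloInformed_sh_dissect`), rule (2) along the sorting permutations `rev ∘ σ⁻¹`; the piece of `σ`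
is Kontsevich's simplex with the word `fill_{c(σ)}(bw(s), bw(t))` (file 2, WORD LEMMA), and the sum
over `σ` is the sum over the shuffle list by the bijection `σ ↔ c(σ)` (file 2) and LEMMA SW (file 1).
Under `evalP` it specialises to the real identity `MZV.…multipleZeta_mul_eq_sum_shuffleWord` of the
Literature, which is therefore a consequence of the three rules alone.

Corollaries: the product of classes of weights `m`, `n` lies in the `ℤ`-span of the classes of
admissible indices of weight `m + n` (`soloInformed_mzvClass_mul_mem_span_weight`); the `ℤ`-span of
all multiple zeta classes is a SUBRING of `𝒫` (`soloInformedMZVSubring`) — the formal MZV ring,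
graded by weight, on which the period conjecture restricted to MZVs is the injectivity of `evalP`.
Smoke test in depth `(1,2)`: `Z(2)·Z(2,1) = 6 Z(3,1,1) + 3 Z(2,2,1) + Z(2,1,2)` in `𝒫` from the
general formula (`soloInformed_mzvClass_two_mul_twoOne`).

References: Kontsevich–Zagier 2001 §1.2 [KontsevichZagier2001]; Ihara–Kaneko–Zagier 2006 §1;
Reutenauer 1993 §1.4; Stanley 1986 (two poset polytopes); Eie 2013 §1.2.
-/

noncomputable section

open MeasureTheory Set
open Literature.ModelTheory.ExponentialFields Literature.NumberTheory.Transcendental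
open Literature.NumberTheory.Transcendental.KZ

namespace Summit.KontsevichZagierPeriods.KontsevichZagierPeriods.Theorems

variable {p q : ℕ}

/-! ## 1. End letters in a general dimension -/

/-- The word of an interleaving of two words beginning with `0` does not begin with `1`
(any dimension). -/
theorem soloInformed_ofFn_fillC_head?_ne {n : ℕ} (c : Fin n → Bool) (u v : List Bool)
    (hu : u.getD 0 false = false) (hv : v.getD 0 false = false) :
    (List.ofFn (soloInformedFillC c u v)).head? ≠ some true := by
  cases n with
  | zero => simp
  | succ m => rw [soloInformed_ofFn_fillC_head? c u v hu hv]; simp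

/-- The word of an interleaving of two words ending with `1` ends with `1` (any positive
dimension). -/
theorem soloInformed_ofFn_fillC_getLast?_eq {n : ℕ} (c : Fin n → Bool) (u v : List Bool)
    (hn : n ≠ 0) (hc : soloInformedCountC c = u.length) (h : u.length + v.length = n)
    (hu : u.getLast? = some true) (hv : v.getLast? = some true) :
    (List.ofFn (soloInformedFillC c u v)).getLast? = some true := by
  cases n with
  | zero => exact absurd rfl hn
  | succ m => exact soloInformed_ofFn_fillC_getLast? c u v hc h hu hv

/-! ## 2. The product representation and its pieces -/

/-- The tensor product of the word-products of `u` and `v` is the word-product of the blockwise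
letter vector `u ++ v`. -/
theorem soloInformed_wordProd_append (u v : List Bool) (z : Fin (p + 2 + (q + 2)) → ℝ) :
    (∏ i : Fin (p + 2), mzvForm (u.getD i false) (z (Fin.castAdd (q + 2) i))) *
        (∏ j : Fin (q + 2), mzvForm (v.getD j false) (z (Fin.natAdd (p + 2) j))) =
      ∏ k : Fin (p + 2 + (q + 2)),
        mzvForm (Fin.append (fun i : Fin (p + 2) => u.getD i false)
          (fun j : Fin (q + 2) => v.getD j false) k) (z k) := by
  rw [Fin.prod_univ_add (fun k : Fin (p + 2 + (q + 2)) => mzvForm (Fin.append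
    (fun i : Fin (p + 2) => u.getD i false) (fun j : Fin (q + 2) => v.getD j false) k) (z k))]
  simp only [Fin.append_left, Fin.append_right]

section Pieces

variable (r : IntegralRep (p + 2 + (q + 2))) {σ : Equiv.Perm (Fin (p + 2 + (q + 2)))}
  (u v : List Bool)

/-- **The integrand of the simplex piece of a linear extension** is the word-product of the
interleaving defined by its colouring (WORD LEMMA, file 2). -/
theorem soloInformed_shAllPiece_integrand
    (hi : ∀ z, r.integrand z = ∏ k, mzvForm (Fin.append (fun i : Fin (p + 2) => u.getD i false)
      (fun j : Fin (q + 2) => v.getD j false) k) (z k))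
    (hσ : soloInformedCompat (soloInformedShPoset p q) σ) (w : Fin (p + 2 + (q + 2)) → ℝ) :
    ((soloInformedCellRep r σ).reindex (soloInformedCellPerm σ)).integrand w =
      ∏ k : Fin (p + 2 + (q + 2)),
        mzvForm ((List.ofFn (soloInformedFillC (soloInformedShColour σ) u v)).getD k false)
          (w k) := by
  show r.integrand (fun i => w (soloInformedCellPerm σ i)) = _
  rw [hi, ← Equiv.prod_comp (soloInformedCellPerm σ) (fun k : Fin (p + 2 + (q + 2)) =>
    mzvForm ((List.ofFn (soloInformedFillC (soloInformedShColour σ) u v)).getD k false) (w k))]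
  refine Finset.prod_congr rfl fun x _ => ?_
  rw [List.getD_eq_getElem _ _ (by rw [List.length_ofFn]; exact Fin.isLt _), List.getElem_ofFn,
    soloInformed_shWord_eq_fillC hσ u v x]

/-- **Each simplex piece IS the multiple zeta class of the interleaved word.** -/
theorem soloInformed_shAllPiece_class
    (hd : r.domain = soloInformedOpenCube _ ∩ soloInformedOrderSet (soloInformedShPoset p q))
    (hi : ∀ z, r.integrand z = ∏ k, mzvForm (Fin.append (fun i : Fin (p + 2) => u.getD i false)
      (fun j : Fin (q + 2) => v.getD j false) k) (z k))
    (hσ : soloInformedCompat (soloInformedShPoset p q) σ)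
    (hul : u.length = p + 2) (hvl : v.length = q + 2)
    (hu0 : u.getD 0 false = false) (hv0 : v.getD 0 false = false)
    (hu1 : u.getLast? = some true) (hv1 : v.getLast? = some true) :
    toFormalPeriod (of ((soloInformedCellRep r σ).reindex (soloInformedCellPerm σ))) =
      mzvClass (MZV.ofBinaryWord (List.ofFn (soloInformedFillC (soloInformedShColour σ) u v))) := by
  have hN : p + 2 + (q + 2) ≠ 0 := by omega
  have hne : List.ofFn (soloInformedFillC (soloInformedShColour σ) u v) ≠ [] := by
    rw [Ne, List.ofFn_eq_nil_iff]
    exact hN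
  have hhead := soloInformed_ofFn_fillC_head?_ne (soloInformedShColour σ) u v hu0 hv0
  have hlast := soloInformed_ofFn_fillC_getLast?_eq (soloInformedShColour σ) u v hN
    (by rw [soloInformed_countC_shColour, hul]) (by rw [hul, hvl]) hu1 hv1
  refine soloInformed_toFormalPeriod_eq_mzvClass (MZV.isAdmissible_ofBinaryWord hhead) ?_ _
    (soloInformed_shPiece_domain r hd hσ) fun w => ?_
  · rw [MZV.weight_ofBinaryWord hne hlast, List.length_ofFn]
  · rw [soloInformed_shAllPiece_integrand r u v hi hσ w, MZV.binaryWord_ofBinaryWord hne hlast]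

/-- The cell piece has the same class (rule (2) along the sorting permutation). -/
theorem soloInformed_shAllCellRep_class
    (hd : r.domain = soloInformedOpenCube _ ∩ soloInformedOrderSet (soloInformedShPoset p q))
    (hi : ∀ z, r.integrand z = ∏ k, mzvForm (Fin.append (fun i : Fin (p + 2) => u.getD i false)
      (fun j : Fin (q + 2) => v.getD j false) k) (z k))
    (hσ : soloInformedCompat (soloInformedShPoset p q) σ)
    (hul : u.length = p + 2) (hvl : v.length = q + 2)
    (hu0 : u.getD 0 false = false) (hv0 : v.getD 0 false = false)
    (hu1 : u.getLast? = some true) (hv1 : v.getLast? = some true) :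
    toFormalPeriod (of (soloInformedCellRep r σ)) =
      mzvClass (MZV.ofBinaryWord (List.ofFn (soloInformedFillC (soloInformedShColour σ) u v))) := by
  rw [← soloInformed_shAllPiece_class r u v hd hi hσ hul hvl hu0 hv0 hu1 hv1, toFormalPeriod_eq_iff]
  exact of_sub_of_reindex_mem_relations _ _

/-- **The class of a representation on `(0,1)ⁿ ∩ P_E` with a blockwise word integrand** is the
sum over the linear extensions of the classes of the interleaved words. -/
theorem soloInformed_shAll_class
    (hd : r.domain = soloInformedOpenCube _ ∩ soloInformedOrderSet (soloInformedShPoset p q))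
    (hi : ∀ z, r.integrand z = ∏ k, mzvForm (Fin.append (fun i : Fin (p + 2) => u.getD i false)
      (fun j : Fin (q + 2) => v.getD j false) k) (z k))
    (hul : u.length = p + 2) (hvl : v.length = q + 2)
    (hu0 : u.getD 0 false = false) (hv0 : v.getD 0 false = false)
    (hu1 : u.getLast? = some true) (hv1 : v.getLast? = some true) :
    toFormalPeriod (of r) =
      ∑ σ ∈ Finset.univ.filter (soloInformedCompat (soloInformedShPoset p q)),
        mzvClass (MZV.ofBinaryWord (List.ofFn (soloInformedFillC (soloInformedShColour σ) u v))) := by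
  rw [toFormalPeriod_eq_iff.2 (soloInformed_sh_dissect r hd), map_sum]
  exact Finset.sum_congr rfl fun σ hσ =>
    soloInformed_shAllCellRep_class r u v hd hi (Finset.mem_filter.1 hσ).2 hul hvl hu0 hv0 hu1 hv1

end Pieces

/-! ## 3. THEOREM XLII — the shuffle product formula in `𝒫` -/

/-- **THEOREM XLII (the shuffle product of multiple zeta classes in the formal period ring).**
For admissible `s, t`:
`mzvClass s * mzvClass t = ∑_{W ∈ bw(s) ш bw(t)} mzvClass (ofBinaryWord W)`, with multiplicity,
by Fubini + rule (1a) + rule (2) only. [Kontsevich–Zagier 2001 §1.2; IKZ 2006 §1] -/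
theorem soloInformed_mzvClass_mul_eq_sum_shuffleWord {s t : List ℕ} (hs : MZV.IsAdmissible s)
    (ht : MZV.IsAdmissible t) :
    mzvClass s * mzvClass t =
      ((MZV.shuffleWord (MZV.binaryWord s) (MZV.binaryWord t)).map
        fun W => mzvClass (MZV.ofBinaryWord W)).sum := by
  by_cases hs0 : s = []
  · subst hs0
    simp [MZV.binaryWord, MZV.ofBinaryWord_binaryWord ht.1]
  by_cases ht0 : t = []
  · subst ht0
    simp [MZV.binaryWord, MZV.ofBinaryWord_binaryWord hs.1]
  obtain ⟨a, s', rfl⟩ := List.exists_cons_of_ne_nil hs0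
  obtain ⟨b, t', rfl⟩ := List.exists_cons_of_ne_nil ht0
  have ha : 2 ≤ a := hs.2 (List.cons_ne_nil a s')
  have hb : 2 ≤ b := ht.2 (List.cons_ne_nil b t')
  obtain ⟨p, hp⟩ : ∃ p, MZV.weight (a :: s') = p + 2 :=
    ⟨MZV.weight (a :: s') - 2, by simp [MZV.weight]; omega⟩
  obtain ⟨q, hq⟩ : ∃ q, MZV.weight (b :: t') = q + 2 :=
    ⟨MZV.weight (b :: t') - 2, by simp [MZV.weight]; omega⟩
  have hul : (MZV.binaryWord (a :: s')).length = p + 2 := by rw [hs.length_binaryWord, hp]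
  have hvl : (MZV.binaryWord (b :: t')).length = q + 2 := by rw [ht.length_binaryWord, hq]
  have hu0 := MZV.getD_binaryWord_cons_zero (s := s') ha
  have hv0 := MZV.getD_binaryWord_cons_zero (s := t') hb
  have hu1 := MZV.getLast?_binaryWord (List.cons_ne_nil a s')
  have hv1 := MZV.getLast?_binaryWord (List.cons_ne_nil b t')
  obtain ⟨ra, hda, hia, hca⟩ := soloInformed_exists_wordRep hs hp
  obtain ⟨rb, hdb, hib, hcb⟩ := soloInformed_exists_wordRep ht hq
  have hd : (ra.prod rb).domain =
      soloInformedOpenCube _ ∩ soloInformedOrderSet (soloInformedShPoset p q) := by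
    rw [IntegralRep.prod_domain, ← soloInformed_prodSimplex_eq]
    ext z
    simp only [IntegralRep.mem_prodDomain, hda, hdb, mem_setOf_eq]
  have hi : ∀ z, (ra.prod rb).integrand z = ∏ k, mzvForm (Fin.append
      (fun i : Fin (p + 2) => (MZV.binaryWord (a :: s')).getD i false)
      (fun j : Fin (q + 2) => (MZV.binaryWord (b :: t')).getD j false) k) (z k) := fun z => by
    rw [IntegralRep.prod_integrand_eq, IntegralRep.prodFun_apply, hia, hib,
      soloInformed_wordProd_append]
  have step2 := soloInformed_sum_shCompat_eq_sum_colouring (p := p) (q := q)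
    fun c => mzvClass (MZV.ofBinaryWord (List.ofFn (soloInformedFillC c
      (MZV.binaryWord (a :: s')) (MZV.binaryWord (b :: t')))))
  have step3 := soloInformed_shuffleWord_sum (MZV.binaryWord (a :: s')) (MZV.binaryWord (b :: t'))
    (p + 2 + (q + 2)) (fun W => mzvClass (MZV.ofBinaryWord W)) (by rw [hul, hvl])
  rw [← hca, ← hcb, ← map_mul, of_mul_of,
    soloInformed_shAll_class (ra.prod rb) _ _ hd hi hul hvl hu0 hv0 hu1 hv1, step2, step3]
  simp only [hul]

/-! ## 4. Corollaries: weight grading and the formal MZV ring -/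

/-- Every interleaving of the words of two admissible indices reads as an admissible index of the
total weight. -/
theorem soloInformed_ofBinaryWord_shuffle_admissible {s t : List ℕ} (hs : MZV.IsAdmissible s)
    (ht : MZV.IsAdmissible t) {W : List Bool}
    (hW : W ∈ MZV.shuffleWord (MZV.binaryWord s) (MZV.binaryWord t)) :
    MZV.IsAdmissible (MZV.ofBinaryWord W) ∧
      MZV.weight (MZV.ofBinaryWord W) = MZV.weight s + MZV.weight t := by
  have hh : ∀ {r : List ℕ}, MZV.IsAdmissible r → (MZV.binaryWord r).head? ≠ some true := by
    intro r hr
    cases r with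
    | nil => simp [MZV.binaryWord]
    | cons a r => rw [MZV.head?_binaryWord (a := a) (s := r) (hr.2 (List.cons_ne_nil a r))]; simp
  have hl : ∀ r : List ℕ, (MZV.binaryWord r).getLast? = some true ∨ MZV.binaryWord r = [] := by
    intro r
    cases r with
    | nil => exact Or.inr rfl
    | cons a r => exact Or.inl (MZV.getLast?_binaryWord (List.cons_ne_nil a r))
  have hlen := MZV.length_of_mem_shuffleWord _ _ hW
  rw [hs.length_binaryWord, ht.length_binaryWord] at hlen
  refine ⟨MZV.isAdmissible_ofBinaryWord ?_, ?_⟩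
  · rcases MZV.head?_of_mem_shuffleWord _ _ hW with h | h
    · rw [h]; exact hh hs
    · rw [h]; exact hh ht
  · by_cases hW0 : W = []
    · subst hW0
      rw [List.length_nil] at hlen
      rw [MZV.ofBinaryWord_nil]
      show ([] : List ℕ).sum = _
      rw [List.sum_nil]
      exact hlen
    · have hlast : W.getLast? = some true := by
        rcases MZV.getLast?_of_mem_shuffleWord _ _ hW with h | h
        · rcases hl s with h' | h'
          · rw [h, h']
          · rw [h', List.getLast?_nil, List.getLast?_eq_none_iff] at h
            exact absurd h hW0
        · rcases hl t with h' | h'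
          · rw [h, h']
          · rw [h', List.getLast?_nil, List.getLast?_eq_none_iff] at h
            exact absurd h hW0
      rw [MZV.weight_ofBinaryWord hW0 hlast, hlen]

/-- **Weight grading.** The product of the classes of admissible indices of weights `m`, `n` lies
in the `ℤ`-span of the classes of admissible indices of weight `m + n`. -/
theorem soloInformed_mzvClass_mul_mem_span_weight {s t : List ℕ} (hs : MZV.IsAdmissible s)
    (ht : MZV.IsAdmissible t) :
    mzvClass s * mzvClass t ∈ Submodule.span ℤ
      {x : FormalPeriodRing | ∃ r : List ℕ, MZV.IsAdmissible r ∧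
        MZV.weight r = MZV.weight s + MZV.weight t ∧ mzvClass r = x} := by
  rw [soloInformed_mzvClass_mul_eq_sum_shuffleWord hs ht]
  refine list_sum_mem fun x hx => ?_
  obtain ⟨W, hW, rfl⟩ := List.mem_map.1 hx
  obtain ⟨hadm, hwt⟩ := soloInformed_ofBinaryWord_shuffle_admissible hs ht hW
  exact Submodule.subset_span ⟨_, hadm, hwt, rfl⟩

/-- The `ℤ`-span of the multiple zeta classes in `𝒫`. -/
def soloInformedMZVSpan : Submodule ℤ FormalPeriodRing :=
  Submodule.span ℤ {x : FormalPeriodRing | ∃ r : List ℕ, MZV.IsAdmissible r ∧ mzvClass r = x}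

/-- Multiple zeta classes lie in the span. -/
theorem soloInformed_mzvClass_mem_mzvSpan {r : List ℕ} (hr : MZV.IsAdmissible r) :
    mzvClass r ∈ soloInformedMZVSpan :=
  Submodule.subset_span ⟨r, hr, rfl⟩

/-- **The span of the multiple zeta classes is closed under multiplication** (THEOREM XLII). -/
theorem soloInformed_mzvSpan_mul_mem {x y : FormalPeriodRing} (hx : x ∈ soloInformedMZVSpan)
    (hy : y ∈ soloInformedMZVSpan) : x * y ∈ soloInformedMZVSpan := by
  unfold soloInformedMZVSpan at hx hy ⊢
  refine Submodule.span_induction (p := fun x _ => x * y ∈ _) ?_ ?_ ?_ ?_ hx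
  · rintro x ⟨r, hr, rfl⟩
    refine Submodule.span_induction (p := fun y _ => mzvClass r * y ∈ _) ?_ ?_ ?_ ?_ hy
    · rintro y ⟨r', hr', rfl⟩
      rw [soloInformed_mzvClass_mul_eq_sum_shuffleWord hr hr']
      refine list_sum_mem fun z hz => ?_
      obtain ⟨W, hW, rfl⟩ := List.mem_map.1 hz
      exact Submodule.subset_span
        ⟨_, (soloInformed_ofBinaryWord_shuffle_admissible hr hr' hW).1, rfl⟩
    · simp
    · intro a b _ _ ha hb
      rw [mul_add]
      exact add_mem ha hb
    · intro n a _ ha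
      rw [mul_smul_comm]
      exact Submodule.smul_mem _ n ha
  · simp
  · intro a b _ _ ha hb
    rw [add_mul]
    exact add_mem ha hb
  · intro n a _ ha
    rw [smul_mul_assoc]
    exact Submodule.smul_mem _ n ha

/-- **The formal MZV ring.** The `ℤ`-span of the multiple zeta classes is a subring of the formal
period ring `𝒫` (`1 = mzvClass []`; products by THEOREM XLII). -/
def soloInformedMZVSubring : Subring FormalPeriodRing where
  carrier := (soloInformedMZVSpan : Set FormalPeriodRing)
  mul_mem' hx hy := soloInformed_mzvSpan_mul_mem hx hy
  one_mem' := by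
    show (1 : FormalPeriodRing) ∈ soloInformedMZVSpan
    rw [← mzvClass_nil]
    exact soloInformed_mzvClass_mem_mzvSpan MZV.isAdmissible_nil
  add_mem' hx hy := add_mem hx hy
  zero_mem' := zero_mem _
  neg_mem' hx := neg_mem hx

/-- Membership in the formal MZV ring is membership in the span. -/
theorem soloInformed_mem_mzvSubring_iff {x : FormalPeriodRing} :
    x ∈ soloInformedMZVSubring ↔ x ∈ soloInformedMZVSpan :=
  Iff.rfl

/-! ## 5. Smoke test in depth (1,2) -/

/-- The ten interleavings of `01` and `011`, read as indices (kernel computation). -/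
theorem soloInformed_shuffleWord_two_twoOne :
    (MZV.shuffleWord (MZV.binaryWord [2]) (MZV.binaryWord [2, 1])).map MZV.ofBinaryWord =
      [[2, 2, 1], [3, 1, 1], [3, 1, 1], [3, 1, 1], [3, 1, 1], [3, 1, 1], [3, 1, 1], [2, 2, 1],
        [2, 2, 1], [2, 1, 2]] := by
  decide

/-- **`Z(2)·Z(2,1) = 6 Z(3,1,1) + 3 Z(2,2,1) + Z(2,1,2)` in `𝒫`**, an instance of THEOREM XLII
beyond depth `(1,1)` (compare `ζ(2)ζ(3) = 6ζ(4,1) + 3ζ(3,2) + ζ(2,3)`, its image under duality). -/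
theorem soloInformed_mzvClass_two_mul_twoOne :
    mzvClass [2] * mzvClass [2, 1] =
      6 • mzvClass [3, 1, 1] + 3 • mzvClass [2, 2, 1] + mzvClass [2, 1, 2] := by
  have h : ((MZV.shuffleWord (MZV.binaryWord [2]) (MZV.binaryWord [2, 1])).map
      fun W => mzvClass (MZV.ofBinaryWord W)) =
      (((MZV.shuffleWord (MZV.binaryWord [2]) (MZV.binaryWord [2, 1])).map MZV.ofBinaryWord).map
        mzvClass) := by
    rw [List.map_map]
    rfl
  rw [soloInformed_mzvClass_mul_eq_sum_shuffleWord (by decide) (by decide), h,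
    soloInformed_shuffleWord_two_twoOne]
  simp only [List.map_cons, List.map_nil, List.sum_cons, List.sum_nil]
  abel

end Summit.KontsevichZagierPeriods.KontsevichZagierPeriods.Theorems
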